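import Summits.QuantumFields.YangMills.Theorems.ColdStartUniversalityLatticeLangevinWilsonReversibleMeasurable
import HarnessLib

/-!
# Route `ColdStartUniversality` (fixed-cut-off package): the SZZ semigroup is an `L²(μ_{β'})`-contraction and the stationary
# autocorrelations `t ↦ ⟨F, P_t F⟩_{μ_{β'}}` are nonnegative and nonincreasing

Helper file (seat `ym-line-csu-p1`, g15).  Consequences of invariance (`integral_transitionKernel_integral_eq_wilson`) and
reversibility (`integral_mul_transition_self_eq_sq`) of the SU(2) lattice Langevin dynamics with respect to the Wilson
measure, for every `L, β'`, every Markov kernel family `κ` realising the transition laws: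

* `sq_integral_le_integral_sq_of_bounded` — Jensen: `(∫ G dν)² ≤ ∫ G² dν` for a probability measure `ν`;
* ★ `integral_sq_transition_le` — `L²(μ)`-CONTRACTION `∫ (κ_s G)² dμ_{β'} ≤ ∫ G² dμ_{β'}` (bounded measurable `G`);
* ★ `integral_mul_transition_self_antitone` — for continuous `F`, `⟨F, P_{t+h} F⟩_μ ≤ ⟨F, P_t F⟩_μ` (`= ‖P_{t/2}F‖²`, then
  contraction), with `integral_mul_transition_self_nonneg` (seat g15): stationary autocorrelations of the SZZ dynamics are
  nonnegative and nonincreasing in time — the spectral (Herglotz) structure of a reversible Markov semigroup.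

THEOREMS ONLY, no definition, no sorry.  RECORD-rung R3 plumbing (fixed cut-off); not the K-uniform crux; YM mass gap NOT proved.
-/

set_option autoImplicit false

noncomputable section

namespace Summit.QuantumFields.YangMills.Theorems.ColdStartUniversality

open MeasureTheory ProbabilityTheory Filter Set
open scoped NNReal ENNReal
open Literature.Probability.Process Literature.MathematicalPhysics.QuantumFieldTheory
open Literature.MathematicalPhysics.QuantumLattice (fundamentalRep fundamentalLatticeRep continuous_fundamentalRep)

variable {L : ℕ} [NeZero L]

/-- **Jensen for a Markov kernel**: `(∫ G dν)² ≤ ∫ G² dν` for a probability measure `ν` and a bounded measurable `G`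
(variance is nonnegative). [folklore] -/
theorem sq_integral_le_integral_sq_of_bounded {Y : Type*} [MeasurableSpace Y] (ν : Measure Y) [IsProbabilityMeasure ν]
    {G : Y → ℝ} (hGm : Measurable G) {C : ℝ} (hC : ∀ y, |G y| ≤ C) :
    (∫ y, G y ∂ν) ^ 2 ≤ ∫ y, (G y) ^ 2 ∂ν := by
  have hLp : MemLp G 2 ν :=
    MemLp.of_bound hGm.aestronglyMeasurable C (ae_of_all _ fun y => by rw [Real.norm_eq_abs]; exact hC y)
  have h := variance_nonneg G ν
  rw [variance_eq_sub hLp] at h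
  have h2 : ν[G ^ 2] = ∫ y, (G y) ^ 2 ∂ν := by rfl
  linarith [h2]

/-- ★ **`L²(μ_{β'})`-contraction of the SZZ transition kernels**: `∫ (∫ G dκ_s x)² dμ_{β'} ≤ ∫ G² dμ_{β'}` for bounded measurable
`G` (Jensen pointwise, then invariance of `μ_{β'}`). [cite: ShenZhuZhu2022, §3 Lemma 3.3 (p. 13)] -/
theorem integral_sq_transition_le (L : ℕ) [NeZero L] (β' : ℝ)
    (κ : ℝ≥0 → Kernel (GaugeConfig 3 L (Matrix.specialUnitaryGroup (Fin 2) ℂ))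
      (GaugeConfig 3 L (Matrix.specialUnitaryGroup (Fin 2) ℂ))) [∀ t, IsMarkovKernel (κ t)]
    (hreal : ∀ (t : ℝ≥0) (x : GaugeConfig 3 L (Matrix.specialUnitaryGroup (Fin 2) ℂ))
        (Ω : Type) [MeasurableSpace Ω] (P : Measure Ω) [IsProbabilityMeasure P]
        (W : ℝ≥0 → Ω → (Edge 3 L × NoiseIdx 2 → ℝ)) (hW : IsFlatBrownian W P)
        (U : ℝ≥0 → Ω → GaugeConfig 3 L (Matrix.specialUnitaryGroup (Fin 2) ℂ)),
        (∀ ω, U 0 ω = x) →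
        (latticeLangevinDynamics (fundamentalLatticeRep 2) β').IsSolution (fundamentalRep (Fin 2))
          hW.natFiltration P W U →
        κ t x = P.map (U t))
    (s : ℝ≥0) {G : GaugeConfig 3 L (Matrix.specialUnitaryGroup (Fin 2) ℂ) → ℝ} (hGm : Measurable G)
    (hGb : ∃ C : ℝ, ∀ x, |G x| ≤ C) :
    ∫ x, (∫ y, G y ∂(κ s x)) ^ 2 ∂(wilsonMeasure (d := 3) (L := L) (fundamentalRep (Fin 2)) β') ≤
      ∫ x, (G x) ^ 2 ∂(wilsonMeasure (d := 3) (L := L) (fundamentalRep (Fin 2)) β') := by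
  classical
  haveI := secondCountableTopology_su2
  haveI := borelSpace_config L
  set μ : Measure (GaugeConfig 3 L (Matrix.specialUnitaryGroup (Fin 2) ℂ)) :=
    wilsonMeasure (d := 3) (L := L) (fundamentalRep (Fin 2)) β' with hμ
  haveI : IsProbabilityMeasure μ :=
    isProbabilityMeasure_wilsonMeasure (d := 3) (L := L) (fundamentalRep (Fin 2)) (continuous_fundamentalRep (Fin 2)) β'
  obtain ⟨C, hC⟩ := hGb
  have hC0 : 0 ≤ C := (abs_nonneg _).trans (hC (Classical.arbitrary _))
  -- `G²` is bounded measurable; invariance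
  have hG2m : Measurable fun x => (G x) ^ 2 := hGm.pow_const 2
  have hG2b : ∀ x, |(G x) ^ 2| ≤ C ^ 2 := fun x => by
    rw [abs_pow]; exact pow_le_pow_left₀ (abs_nonneg _) (hC x) 2
  have hinv : ∫ x, (∫ y, (G y) ^ 2 ∂(κ s x)) ∂μ = ∫ x, (G x) ^ 2 ∂μ :=
    integral_transitionKernel_integral_eq_wilson (L := L) β' κ hreal s hG2m ⟨C ^ 2, hG2b⟩
  rw [← hinv]
  -- pointwise Jensen, then monotonicity of the integral
  have hpt : ∀ x, (∫ y, G y ∂(κ s x)) ^ 2 ≤ ∫ y, (G y) ^ 2 ∂(κ s x) := fun x =>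
    sq_integral_le_integral_sq_of_bounded (κ s x) hGm hC
  have hm1 : Measurable fun x => ∫ y, G y ∂(κ s x) := (hGm.stronglyMeasurable.integral_kernel (κ := κ s)).measurable
  have hm2 : Measurable fun x => ∫ y, (G y) ^ 2 ∂(κ s x) := (hG2m.stronglyMeasurable.integral_kernel (κ := κ s)).measurable
  have hb1 : ∀ x, |∫ y, G y ∂(κ s x)| ≤ C := fun x => abs_integral_le_of_abs_le_of_isProbabilityMeasure hC
  have hi1 : Integrable (fun x => (∫ y, G y ∂(κ s x)) ^ 2) μ :=
    (integrable_const (C ^ 2)).mono' (hm1.pow_const 2).aestronglyMeasurable (ae_of_all _ fun x => by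
      rw [Real.norm_eq_abs, abs_pow]; exact pow_le_pow_left₀ (abs_nonneg _) (hb1 x) 2)
  have hi2 : Integrable (fun x => ∫ y, (G y) ^ 2 ∂(κ s x)) μ :=
    (integrable_const (C ^ 2)).mono' hm2.aestronglyMeasurable (ae_of_all _ fun x => by
      rw [Real.norm_eq_abs]; exact abs_integral_le_of_abs_le_of_isProbabilityMeasure hG2b)
  exact integral_mono hi1 hi2 hpt

/-- ★ **Stationary autocorrelations are nonincreasing**: for continuous `F` and lattice times `t, h`,
`∫ F · κ_{t+h} F dμ_{β'} ≤ ∫ F · κ_t F dμ_{β'}` — with `integral_mul_transition_self_eq_sq`, `⟨F, P_{t+h}F⟩ = ‖P_{(t+h)/2}F‖²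
= ‖P_{h/2} P_{t/2} F‖² ≤ ‖P_{t/2}F‖² = ⟨F, P_t F⟩` (Chapman–Kolmogorov and the `L²`-contraction).
[cite: ShenZhuZhu2022, §3 (p. 13)] -/
theorem integral_mul_transition_self_antitone (L : ℕ) [NeZero L] (β' : ℝ)
    (κ : ℝ≥0 → Kernel (GaugeConfig 3 L (Matrix.specialUnitaryGroup (Fin 2) ℂ))
      (GaugeConfig 3 L (Matrix.specialUnitaryGroup (Fin 2) ℂ))) [∀ t, IsMarkovKernel (κ t)]
    (hreal : ∀ (t : ℝ≥0) (x : GaugeConfig 3 L (Matrix.specialUnitaryGroup (Fin 2) ℂ))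
        (Ω : Type) [MeasurableSpace Ω] (P : Measure Ω) [IsProbabilityMeasure P]
        (W : ℝ≥0 → Ω → (Edge 3 L × NoiseIdx 2 → ℝ)) (hW : IsFlatBrownian W P)
        (U : ℝ≥0 → Ω → GaugeConfig 3 L (Matrix.specialUnitaryGroup (Fin 2) ℂ)),
        (∀ ω, U 0 ω = x) →
        (latticeLangevinDynamics (fundamentalLatticeRep 2) β').IsSolution (fundamentalRep (Fin 2))
          hW.natFiltration P W U →
        κ t x = P.map (U t))
    (t h : ℝ≥0) {F : GaugeConfig 3 L (Matrix.specialUnitaryGroup (Fin 2) ℂ) → ℝ} (hF : Continuous F) :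
    ∫ x, F x * (∫ y, F y ∂(κ (t + h) x)) ∂(wilsonMeasure (d := 3) (L := L) (fundamentalRep (Fin 2)) β') ≤
      ∫ x, F x * (∫ y, F y ∂(κ t x)) ∂(wilsonMeasure (d := 3) (L := L) (fundamentalRep (Fin 2)) β') := by
  classical
  haveI := secondCountableTopology_su2
  haveI := borelSpace_config L
  obtain ⟨M, hM0, hM⟩ := exists_abs_le_of_continuous hF
  -- both sides as squares
  have et : t = t / 2 + t / 2 := (add_halves t).symm
  have eth : t + h = (t / 2 + h / 2) + (t / 2 + h / 2) := by
    rw [show t / 2 + h / 2 + (t / 2 + h / 2) = (t / 2 + t / 2) + (h / 2 + h / 2) by ring, add_halves, add_halves]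
  rw [eth, integral_mul_transition_self_eq_sq L β' κ hreal (t / 2 + h / 2) hF]
  conv_rhs => rw [et, integral_mul_transition_self_eq_sq L β' κ hreal (t / 2) hF]
  -- `κ_{h/2 + t/2} = κ_{t/2} ∘ₖ κ_{h/2}` (tree convention `κ (s + t) = κ t ∘ₖ κ s`): `∫ F dκ_{t/2+h/2} x = ∫ (κ_{t/2} F) dκ_{h/2} x`
  have hFi : ∀ (ν : Measure (GaugeConfig 3 L (Matrix.specialUnitaryGroup (Fin 2) ℂ))) [IsProbabilityMeasure ν],
      Integrable F ν := fun ν _ =>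
    Integrable.of_bound hF.aestronglyMeasurable M (Eventually.of_forall fun z => by rw [Real.norm_eq_abs]; exact hM z)
  have hCK' : κ (h / 2 + t / 2) = κ (t / 2) ∘ₖ κ (h / 2) := chapmanKolmogorov_szz β' κ hreal (h / 2) (t / 2)
  have e2 : ∀ x, ∫ y, F y ∂(κ (t / 2 + h / 2) x) = ∫ y, (∫ z, F z ∂(κ (t / 2) y)) ∂(κ (h / 2) x) := by
    intro x
    haveI : IsProbabilityMeasure ((κ (t / 2) ∘ₖ κ (h / 2)) x) := by rw [← hCK']; infer_instance
    rw [add_comm, hCK']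
    exact Kernel.integral_comp (hFi _)
  simp_rw [e2]
  -- contraction with `G = κ_{t/2} F` (continuous hence bounded measurable)
  have hGc : Continuous fun y => ∫ z, F z ∂(κ (t / 2) y) := continuous_integral_transitionKernel L β' κ hreal (t / 2) hF
  have hGb : ∃ C : ℝ, ∀ y, |∫ z, F z ∂(κ (t / 2) y)| ≤ C := ⟨M, fun y => abs_integral_le_of_abs_le_of_isProbabilityMeasure hM⟩
  exact integral_sq_transition_le L β' κ hreal (h / 2) hGc.measurable hGb

end Summit.QuantumFields.YangMills.Theorems.ColdStartUniversality

end
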